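/-
Copyright (c) 2026 the pub-hodgecm-mathlib formalisation cell (harness21).  Prover seat hodgecm-mathlib-LH4-p04 (g5), Track A «(D-RAM) FOUR-FRAME», unit U2H, the census leaf
(ρ2b′-X) `stub_U2H_fixedPointCensus_typeTwo_unit0` — socket (C) (type RamM bottom; dealer WORD #30: lead LH4-p04 + LH4-p06), organ (C-3′) «THE WELD OF THE FRAME»: the
(C) census identity with EVERY per-cell fact discharged from the frame letters — type-free (one abstract dyadic field `K`).  2026-09-04.
-/
import Summits.HodgeConjecture.HodgeConjecture.Theorems.F0P3cDyRamToricCensusSumRamMWeld                 -- ★ p858199 (this seat): (C-3) `toricCensusSum_ramM_weld`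
import Summits.HodgeConjecture.HodgeConjecture.Theorems.F0P3cDyRamToricLevelCensusRamMAtThirdField        -- ★ p857945 (LH4-p07): K′ package `exists_thirdFieldPackage_ramM`
import Summits.HodgeConjecture.HodgeConjecture.Theorems.F0P3cDyRamToricLevelCensusRamMTables               -- ★ p858235 (LH4-p06): (C-1P) `ncard_levelSet_eq_hnP`
import Summits.HodgeConjecture.HodgeConjecture.Theorems.F0P3cDyRamToricLevelCensusRamMTablesAniso          -- ★ p858252 (LH4-p06): (C-1M) `ncard_levelSet_eq_hnM`
import Summits.HodgeConjecture.HodgeConjecture.Theorems.F0P3cDyRamToricLevelCensusRamMTopCellsNear         -- ★ p858164 (LH4-p06): (C-2TOPnear) `ncard_levelSetDep_top_eq_of_near`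
import Summits.HodgeConjecture.HodgeConjecture.Theorems.F0P3cDyRamToricLevelCensusRamMWeldFar              -- ★ p858345 (LH4-p06): (C-2TOPfar) `hC2TOPfar_of_letters`
import Summits.HodgeConjecture.HodgeConjecture.Theorems.F0P3cDyRamClassLettersRamM                        -- ★ p858341 (F0P3a-p01 (g34)): (C-1cls) class letters
import Summits.HodgeConjecture.HodgeConjecture.Theorems.F0P3cDyRamClassLettersRelative                    -- ★ (F0P3a-p01 (g34)): (C-1cls) `exists_relative_translator`
import HarnessLib

/-!
# F0 · P3c · line LH4 «(D-RAM) FOUR-FRAME» — leaf (ρ2b′-X), socket (C) type RamM, organ (C-3′): THE WELD OF THE FRAME (Rogawski 1990 §4.9; Kottwitz 1986 §1)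

Cell `pub/hodgecm-mathlib` (D-0151), crux H413 = `stmt-HodgeConjecture-24833` (helper lane `--supports stmt-HodgeConjecture-24833 --as helper`, count-neutral); THEOREMS ONLY (no
definition, no instance, no notation, no named fact, no `sorry`, default heartbeats).  Socket served: the typed order-count socket (C) `SOCKET-hOCC.v1` 869d0c15 (payer LH4-p14).

★ p858199 `toricCensusSum_ramM_weld` turns SIX per-cell facts about the two toric level censuses `#levelSetDep(j, a; λ − u)` of the frames `h` (hyperbolic) and `h′`
(anisotropic) into the (C) identity `ε·ΣΣ q^a (#dep_h − #dep_{h′}) = q^m·(2Σ_{i ≤ (jl−g)/2} q^i − 2Σ_{i < g+s0−(g+s0)%2} q^i)`.  THIS FILE discharges all six from the FRAME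
LETTERS of one abstract dyadic field `K` — the three ramified quadratic data `(ρ, ϖM, d_ρ)`, `(Θ, ϖM, d_Θ = 2g)`, `(τ = Θρ, ϖM, d_τ = 2s0)` at ONE uniformiser, the Klein
letters `2dK = d_ρ + 2g`, `2d′ = d_ρ + d_τ`, the fixed-fixed law `hF4`, the norm clause `hFN`, the `Θ`-unit dichotomy `(c₀, hdich)` with the anchor `n₀ ∉ N_Θ`, the scalars
`h` (hyperbolic, `Θh = h`) and `h′` (anisotropic) with their half-orders `vh + d_ρ = 2e`, the tokens `|λ − u| = |ϖE|^m`, `|(λ−u) − ρ(λ−u)| = |ϖE^{jl}(ϖM − ρϖM)|`, the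
parity∕window∕regime letters of (C-5c), and the four SIDE LETTERS of (C-5b) (hypotheses `hST hSE hSP hSM`, F0P3a-p01 (g34)'s Σ3) — by composing ★ organs only:
(C-0c) the third-field package ★ p857945; (C-1cls) the class letters ★ p858341 + the relative translator ★ `exists_relative_translator`; (C-1) the u-free tables ★
p858235 ∕ ★ p858252; (C-2GEN∕OFF) ★ `levelSetDep_eq_of_generic_ramified`; (C-2TOPnear) ★ p858164; (C-2TOPfar) ★ p858345 (τ-datum, `P := ϖM·τϖM`); (C-3) ★ p858199.
**`toricCensusSum_ramM_weld_of_frame`** is the ONE call the (C) head `orderCountCensusC` makes between its re-indexing (★ p858280) and its closing arithmetic (★ p858013).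
HONEST LABEL: HC_CM is proved only modulo the 7 printed citations (2 remaining named inputs: hLiu418 = stmt-HodgeConjecture-24832, h413 = stmt-HodgeConjecture-24833) until rung 0
closes; (ρ2b′-X) :418 is an OPEN prover target — this file is a helper (`--supports`), proofs only, pure composition of ★ organs; nothing printed is asserted.

## References
* [Rogawski1990] J. D. Rogawski, *Automorphic Representations of Unitary Groups in Three Variables*, Ann. of Math. Stud. 123 (1990), §4.9 pp. 55–58, Prop. 4.9.1, Lemma 4.9.3 (the ramified elliptic torus census).
* [Kottwitz1986BaseChangeUnits] R. E. Kottwitz, *Base change for unit elements of Hecke algebras*, Compositio Math. 60 (1986), §1 pp. 240–241 (fixed self-dual lattices).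
* [Serre1979] J.-P. Serre, *Local Fields*, GTM 67 (1979): Ch. IV §1–§2 (ramification of a wild quadratic involution), Ch. V §3 (norm groups).
-/

set_option autoImplicit false

noncomputable section

open scoped Valued Classical
open WithZero IsLocalRing Finset
open Literature.NumberTheory.Automorphic.UnitaryThreeFourFrame (IsRamifiedQuadraticDatum)
open Summit.HodgeConjecture.HodgeConjecture.Cruxes.H413.F0P3cDyRamToricCensusDefs
open Summit.HodgeConjecture.HodgeConjecture.Cruxes.H413.F0P3cDyRamToricLevelCensusRamM (levelSetDep_eq_of_generic_ramified toricCensusSum_ramM_weld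
  ncard_levelSet_eq_hnP ncard_levelSet_eq_hnM ncard_levelSetDep_top_eq_of_near hC2TOPfar_of_letters)
open Summit.HodgeConjecture.HodgeConjecture.Cruxes.H413.F0P3cDyRamToricLevelCensusRamMAtThirdField (exists_thirdFieldPackage_ramM)
open Summit.HodgeConjecture.HodgeConjecture.Cruxes.H413.F0P3cDyRamClassLettersRelative (exists_relative_translator)

namespace Summit.HodgeConjecture.HodgeConjecture.Cruxes.H413.F0P3cDyRamToricCensusSumRamMWeldOfFrame

/-- **THE WELD OF THE FRAME (socket (C), type RamM) — type-free.**  On one abstract complete dyadic field `K` with finite residue field of even cardinality `q`, under the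
frame letters listed in the module docstring and the four side letters `hST hSE hSP hSM` of (C-5b) for a rational sign `ε ∈ {1} ∪ ({−1} ∩ window)`:
`ε·Σ_{j ≤ jl} Σ_{a ≤ jl+1} q^a·(#levelSetDep_h(j, a; λ−u) − #levelSetDep_{h′}(j, a; λ−u)) = q^m·(2·Σ_{i ≤ (jl−g)/2} q^i − 2·Σ_{i < g+s0−(g+s0)%2} q^i)`.
Pure composition: ★ p857945 (K′ package) → ★ p858341 ∕ ★ `exists_relative_translator` (class letters) → ★ p858235 ∕ p858252 (tables) → ★ `levelSetDep_eq_of_generic_ramified`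
(GEN∕OFF) → ★ p858164 (near) → ★ p858345 (far) → ★ p858199 (weld).
[cite: Rogawski1990, §4.9 pp. 55–58, Prop. 4.9.1, Lemma 4.9.3] [cite: Kottwitz1986BaseChangeUnits, §1 pp. 240–241] [cite: Serre1979, Ch. IV §1–§2; Ch. V §3] -/
theorem toricCensusSum_ramM_weld_of_frame
    {K : Type} [Field K] [Valued K ℤᵐ⁰] [CompleteSpace K] [IsDiscreteValuationRing 𝒪[K]] [Finite 𝓀[K]] {ρ Θ τ : K →+* K}
    (hρρ : ∀ x, ρ (ρ x) = x) (hvρ : ∀ x, Valued.v (ρ x) = Valued.v x)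
    (hΘΘ : ∀ x, Θ (Θ x) = x) (hΘρ : ∀ x, Θ (ρ x) = ρ (Θ x)) (hvΘ : ∀ x, Valued.v (Θ x) = Valued.v x) (hτ : ∀ x, τ x = Θ (ρ x))
    (hΘres : ∀ x : K, Valued.v x ≤ 1 → Valued.v (x - Θ x) < 1)
    {ϖM : K} (hϖM : Valued.v ϖM = exp (-1 : ℤ)) {dρ dΘ dτ t : ℕ}
    (hDρ : IsRamifiedQuadraticDatum ρ ϖM dρ t) (hDΘ : IsRamifiedQuadraticDatum Θ ϖM dΘ t) (hDτ : IsRamifiedQuadraticDatum τ ϖM dτ t)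
    (hF4 : ∀ z : K, ρ z = z → Θ z = z → z ≠ 0 → ∃ n : ℤ, Valued.v z = exp (4 * n))
    (hFN : ∀ f : K, ρ f = f → Θ f = f → Valued.v f = 1 → ∃ z : K, z * Θ z = f)
    {c₀ : K} (hc₀ : Valued.v c₀ = 1) (hdich : ∀ u : K, Θ u = u → Valued.v u = 1 → (∃ z : K, z * Θ z = u) ∨ ∃ z : K, z * Θ z = c₀ * u)
    {n₀ : K} (hΘn₀ : Θ n₀ = n₀) (hn₀1 : Valued.v n₀ = 1) (hn₀N : ¬ ∃ z : K, z * Θ z = n₀)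
    {ϖE : K} (hϖE : Valued.v ϖE = exp (-2 : ℤ)) (hρϖ : ρ ϖE = ϖE)
    {q : ℕ} (hq : Nat.card 𝓀[K] = q) (hq2 : 2 ∣ q)
    {g s0 dK d' : ℕ} (hg2 : dΘ = 2 * g) (hs02 : dτ = 2 * s0) (hg1 : 1 ≤ g) (hs01 : 1 ≤ s0)
    (hdKv : Valued.v (ϖM * τ ϖM - ρ (ϖM * τ ϖM)) = exp (-(2 * (dK : ℤ)))) (hdK2 : 2 * dK = dρ + 2 * g)
    (hd'v : Valued.v (ϖM * Θ ϖM - ρ (ϖM * Θ ϖM)) = exp (-(2 * (d' : ℤ)))) (hd'2 : 2 * d' = dρ + dτ)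
    {h h' : K} (hΘh : Θ h = h) (hh : h ≠ 0) (hhyper : ∃ x : K, x ≠ 0 ∧ h * Θ x * x + ρ (h * Θ x * x) = 0)
    (hΘh' : Θ h' = h') (hh' : h' ≠ 0) (haniso : ¬ ∃ x : K, x ≠ 0 ∧ h' * Θ x * x + ρ (h' * Θ x * x) = 0)
    {vh vh' e e' : ℤ} (hvh : Valued.v h = exp (-vh)) (hvh' : Valued.v h' = exp (-vh')) (he : vh + dρ = 2 * e) (he' : vh' + dρ = 2 * e')
    {lam u : K} (hlamΘ : lam * Θ lam = 1) (hu : ρ u = u) (hu1' : u * Θ u = 1)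
    {m jl : ℕ} (hμ : Valued.v (lam - u) = Valued.v ϖE ^ m) (hjl : Valued.v ((lam - u) - ρ (lam - u)) = Valued.v (ϖE ^ jl * (ϖM - ρ ϖM)))
    (hjlg : jl % 2 = g % 2) (hmjl : m ≤ jl) (hdeep : 3 * (g + s0) ≤ m)
    (hparW : m % 2 = (g + s0) % 2 ∨ jl + 2 ≤ m + 2 * g + s0)
    (hreg : (m + s0 ≤ jl ∧ (m + s0) % 2 = jl % 2) ∨ jl + 1 = m + s0)
    (ε : ℚ) (hεQ : ε = 1 ∨ (ε = -1 ∧ jl + 2 ≤ m + 2 * g + s0))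
    -- (C-5b) Σ3 the four SIDE LETTERS (F0P3a-p01 (g34)): regime A (`m + s0 ≤ jl`) TP∕TE, regime B (`jl + 1 = m + s0`) the η-bits
    (hST : m + s0 ≤ jl → (∃ ω : K, Valued.v ω = 1 ∧
      Valued.v (ρ (lam - u) / (lam - u) * (ρ (ω * Θ ω) / (ω * Θ ω)) - 1) ≤ exp (-(2 * ((s0 : ℤ) + 2 * g - 1) + dρ))) → ε = 1)
    (hSE : m + s0 ≤ jl → (∃ ω : K, Valued.v ω = 1 ∧
      Valued.v (ρ (lam - u) / (lam - u) * (ρ n₀ / n₀) * (ρ (ω * Θ ω) / (ω * Θ ω)) - 1) ≤ exp (-(2 * ((s0 : ℤ) + 2 * g - 1) + dρ))) → ε = -1)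
    (hSP : jl + 1 = m + s0 → (∃ ω₁ : Kˣ, Valued.v (ω₁ : K) = 1 ∧
      Valued.v (1 + ρ h / h * (ρ (ϖM ^ ((m : ℤ) - jl - e) * Θ (ϖM ^ ((m : ℤ) - jl - e))) / (ϖM ^ ((m : ℤ) - jl - e) * Θ (ϖM ^ ((m : ℤ) - jl - e)))) /
        (ρ (lam - u) / (lam - u)) * (ρ ((ω₁ : K) * Θ ω₁) / ((ω₁ : K) * Θ ω₁))) ≤ exp (-(2 * ((s0 : ℤ) + 2 * g - 1) + dρ))) → ε = 1)
    (hSM : jl + 1 = m + s0 → (∃ ω₁ : Kˣ, Valued.v (ω₁ : K) = 1 ∧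
      Valued.v (1 + ρ h' / h' * (ρ (ϖM ^ ((m : ℤ) - jl - e') * Θ (ϖM ^ ((m : ℤ) - jl - e'))) / (ϖM ^ ((m : ℤ) - jl - e') * Θ (ϖM ^ ((m : ℤ) - jl - e')))) /
        (ρ (lam - u) / (lam - u)) * (ρ ((ω₁ : K) * Θ ω₁) / ((ω₁ : K) * Θ ω₁))) ≤ exp (-(2 * ((s0 : ℤ) + 2 * g - 1) + dρ))) → ε = -1) :
    ε * ∑ j ∈ range (jl + 1), ∑ a ∈ range (jl + 2), (q : ℚ) ^ a *
        (((levelSetDep ρ Θ ϖM ϖE h j a (lam - u)).ncard : ℚ) - ((levelSetDep ρ Θ ϖM ϖE h' j a (lam - u)).ncard : ℚ)) =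
      (q : ℚ) ^ m * (2 * ∑ i ∈ range ((jl - g) / 2 + 1), (q : ℚ) ^ i - 2 * ∑ i ∈ range (g + s0 - (g + s0) % 2), (q : ℚ) ^ i) := by
  have hds : 2 * d' = dρ + 2 * s0 := by omega
  -- (C-0c) THE THIRD-FIELD PACKAGE `K′ = K♮` (★ p857945, LH4-p07)
  obtain ⟨K', instF', instV', σ', π', jK, instDVR', instFin', hqK', instCS', hσ', hvσ', hfix', hπ', hdd', hjle, hjΘ, hjfixΘ, hjσ, hjπ, -⟩ :=
    exists_thirdFieldPackage_ramM hρρ hvρ hΘρ hDΘ hΘres hF4 hd'v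
  have hqK'q : Nat.card 𝓀[K'] = q := hqK'.trans hq
  -- (C-1cls) letters of the class-letter heads: `P := ϖM·ΘϖM`, `d′` = the dictionary's (`hd'v`)
  have hΘPcls : Θ (ϖM * Θ ϖM) = ϖM * Θ ϖM := by rw [map_mul, hΘΘ, mul_comm]
  have hvPcls : Valued.v (ϖM * Θ ϖM) = exp (-2 : ℤ) := by rw [map_mul, hvΘ, hϖM, ← exp_add]; rfl
  have hϖMne : ϖM ≠ 0 := fun h0 => by rw [h0, map_zero] at hϖM; exact (WithZero.coe_ne_zero hϖM.symm).elim
  have hcls0 : ∀ k₀ : ℤ, Valued.v (1 + ρ h / h * (ρ (ϖM ^ k₀ * Θ (ϖM ^ k₀)) / (ϖM ^ k₀ * Θ (ϖM ^ k₀)))) ≤ exp (-(2 * (d' : ℤ) - 2)) := by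
    exact F0P3cDyRamClassLettersRamM.hcls0_ramM hρρ hΘΘ hΘρ hF4 hΘPcls hvPcls hd'v hϖMne hΘh hh
  have hclsT : ∀ k₀ : ℤ, (∃ r : ℤ, k₀ + s0 + e = 2 * r) → ∃ ω₀ : Kˣ, Valued.v (ω₀ : K) = 1 ∧
      ρ h / h * (ρ (ϖM ^ k₀ * Θ (ϖM ^ k₀)) / (ϖM ^ k₀ * Θ (ϖM ^ k₀))) * (ρ ((ω₀ : K) * Θ ω₀) / ((ω₀ : K) * Θ ω₀)) = -1 := by
    exact F0P3cDyRamClassLettersRamM.hclsT_ramM hρρ hΘΘ hΘρ hvΘ hF4 hΘPcls hd'v hϖM hϖE hρϖ hΘh hh hvh he hds hhyper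
  have hclsO : ∀ k₀ : ℤ, (∃ r : ℤ, k₀ + s0 + e = 2 * r + 1) → ∀ ω : Kˣ, Valued.v (ω : K) = 1 →
      ¬ Valued.v (1 + ρ h / h * (ρ (ϖM ^ k₀ * Θ (ϖM ^ k₀)) / (ϖM ^ k₀ * Θ (ϖM ^ k₀))) * (ρ ((ω : K) * Θ ω) / ((ω : K) * Θ ω))) ≤
        exp (-(2 * (d' : ℤ))) := by
    exact F0P3cDyRamClassLettersRamM.hclsO_ramM hρρ hΘΘ hΘρ hvΘ hF4 hΘPcls hvPcls hd'v hϖM hΘh hh hvh he hds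
  have hcls0' : ∀ k₀ : ℤ, Valued.v (1 + ρ h' / h' * (ρ (ϖM ^ k₀ * Θ (ϖM ^ k₀)) / (ϖM ^ k₀ * Θ (ϖM ^ k₀)))) ≤ exp (-(2 * (d' : ℤ) - 2)) := by
    exact F0P3cDyRamClassLettersRamM.hcls0_ramM hρρ hΘΘ hΘρ hF4 hΘPcls hvPcls hd'v hϖMne hΘh' hh'
  have hclsE : ∀ k₀ : ℤ, (∃ r : ℤ, k₀ + s0 + e' = 2 * r) → ∃ ω₀ : Kˣ, Valued.v (ω₀ : K) = 1 ∧
      ρ h' / h' * (ρ (ϖM ^ k₀ * Θ (ϖM ^ k₀)) / (ϖM ^ k₀ * Θ (ϖM ^ k₀))) * (ρ ((ω₀ : K) * Θ ω₀) / ((ω₀ : K) * Θ ω₀)) * (ρ n₀ / n₀) = -1 := by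
    exact F0P3cDyRamClassLettersRamM.hclsE_ramM hρρ hΘΘ hΘρ hvΘ hc₀ hdich hΘn₀ hn₀1 hn₀N hΘPcls hd'v hϖM hϖE hρϖ hΘh' hh' hvh' he' hds haniso
  have hclsO' : ∀ k₀ : ℤ, (∃ r : ℤ, k₀ + s0 + e' = 2 * r + 1) → ∀ ω : Kˣ, Valued.v (ω : K) = 1 →
      ¬ Valued.v (1 + ρ h' / h' * (ρ (ϖM ^ k₀ * Θ (ϖM ^ k₀)) / (ϖM ^ k₀ * Θ (ϖM ^ k₀))) * (ρ ((ω : K) * Θ ω) / ((ω : K) * Θ ω))) ≤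
        exp (-(2 * (d' : ℤ))) := by
    exact F0P3cDyRamClassLettersRamM.hclsO_ramM hρρ hΘΘ hΘρ hvΘ hF4 hΘPcls hvPcls hd'v hϖM hΘh' hh' hvh' he' hds
  -- (C-1) THE u-FREE TABLES (★ p858235 ∕ ★ p858252, LH4-p06 (g5))
  have hC1P : ∀ j a, (levelSet ρ Θ ϖM (ϖE) h j a).ncard = _ := fun j a =>
    ncard_levelSet_eq_hnP hDρ hΘρ hvΘ hϖE hρϖ hq hqK'q hq2 hσ' hvσ' hfix' hπ' hdd' jK hjle hjΘ hjfixΘ hjσ hjπ hDΘ hFN hΘh hh hvh he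
      hg2 hds hs01 hcls0 hclsT hclsO j a
  have hC1M : ∀ j a, (levelSet ρ Θ ϖM (ϖE) h' j a).ncard = _ := fun j a =>
    ncard_levelSet_eq_hnM hDρ hΘρ hvΘ hϖE hρϖ hq hqK'q hσ' hvσ' hfix' hπ' hdd' jK hjle hjΘ hjfixΘ hjσ hjπ hDΘ hFN hΘn₀ hn₀1 hn₀N hΘh' hh' hvh' he'
      hg2 hds hs01 hcls0' hclsE hclsO' j a
  -- (C-2TOPnear) NEAR TOP CELLS AGREE (★ p858164, LH4-p06 (g5)) — modulo the RELATIVE CLASS LETTER `hrel` ((C-1cls), F0P3a-p01 (g34))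
  obtain ⟨ω_r, hω_r, hrel⟩ : ∃ ω_r : Kˣ, Valued.v (ω_r : K) = 1 ∧
      ρ h' / h' * (ρ (ϖM ^ (m - jl - e' : ℤ) * Θ (ϖM ^ (m - jl - e' : ℤ))) / (ϖM ^ (m - jl - e' : ℤ) * Θ (ϖM ^ (m - jl - e' : ℤ)))) =
        ρ h / h * (ρ (ϖM ^ (m - jl - e : ℤ) * Θ (ϖM ^ (m - jl - e : ℤ))) / (ϖM ^ (m - jl - e : ℤ) * Θ (ϖM ^ (m - jl - e : ℤ)))) * (ρ n₀ / n₀) *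
          (ρ ((ω_r : K) * Θ ω_r) / ((ω_r : K) * Θ ω_r)) := by
    exact exists_relative_translator (ρ := ρ) hΘΘ hvΘ hc₀ hdich hΘn₀ hn₀1 hn₀N hϖM hΘh hΘh' hh hh' hhyper haniso hvh hvh'
      (k₀ := (m : ℤ) - jl - e) (k₀' := (m : ℤ) - jl - e') (by omega)   -- ★ (F0P3a-p01 (g34)) `exists_relative_translator`
  have hC2near : ∀ j a, j ≤ jl → a ≤ j → ¬ (a ≤ m ∧ (j + a ≤ m ∨ (2 * a ≤ m ∧ j + a ≤ jl))) → j + m = jl + a → j + a + 2 ≤ m + s0 + 2 * g →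
      (levelSetDep ρ Θ ϖM (ϖE) h j a (lam - u)).ncard = (levelSetDep ρ Θ ϖM (ϖE) h' j a (lam - u)).ncard :=
    fun j a hj _ hng hdiag hnear =>
      ncard_levelSetDep_top_eq_of_near hDρ hΘρ hvΘ hϖE hρϖ hq hσ' hvσ' hfix' hπ' hdd' jK hjle hjΘ hjfixΘ hjσ hjπ hDΘ hFN hΘn₀ hn₀1 hn₀N
        hh hvh hh' hvh' hμ hjl hg2 hds (k₀ := (m : ℤ) - jl - e) (by omega) (k₀' := (m : ℤ) - jl - e') (by omega) hω_r hrel hj hng hdiag hnear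
  -- (C-2TOPfar) FAR TOP CELLS (★ p858345 `hC2TOPfar_of_letters`, LH4-p06 (g5)): the τ-datum, `P := ϖM·τϖM`, the class letters, `hrel`, and the SIDE LETTERS ((C-5b) Σ3, F0P3a-p01 (g34))
  have hτP : τ (ϖM * τ ϖM) = ϖM * τ ϖM := by rw [map_mul, hDτ.1, mul_comm]
  have hPτ : Valued.v (ϖM * τ ϖM) = exp (-2 : ℤ) := by rw [map_mul, hDτ.2.1, hϖM, ← exp_add]; rfl
  have hmd : g + s0 ≤ m + 1 := by omega
  have hjlS1 : 2 * s0 + g ≤ jl + 2 := by omega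
  have hC2far := hC2TOPfar_of_letters hDρ hΘρ hvΘ hτ hDτ hτP hPτ hdKv hσ' hvσ' hfix' hπ' hdd' jK hjle hjΘ hjfixΘ hjσ hjπ hDΘ hFN hΘn₀ hn₀1 hn₀N
    hϖE hρϖ hq hqK'q hq2 hΘh hh hvh hΘh' hh' hvh' hlamΘ hu hu1' hμ hjl hg2 hs02 hd'2 hdK2 he he' hreg hmd hjlS1
    hcls0 hclsT hclsO hcls0' hclsE hclsO' hω_r hrel ε hST hSE hSP hSM
  -- (C-3) THE WELD (★ p858199, this seat) — per-cell facts: (C-1) tables ★, (C-2) GEN∕OFF (★ RamMDep), near ★ p858164, far (★ TopCellsFar + (C-2TOP-odd))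
  have hq2le : 2 ≤ q := by
    have h1 : 1 < Nat.card 𝓀[K] := Finite.one_lt_card
    omega
  have hjlS : 3 * g + 2 * s0 ≤ jl + 2 + 2 * ((g + s0) % 2) := by omega
  have hmS : g + s0 - (g + s0) % 2 ≤ m + 1 := by omega
  have hW := toricCensusSum_ramM_weld (Θ := Θ) (μ := lam - u) hDρ hvΘ hρϖ hϖE hh hh' q ε hq2le hg1 hs01 hjlg hjlS hparW hmS hmjl hεQ
    hC1P hC1M
    (fun j a hj _ hG => by   -- (C-2GEN) ★ RamMDep
      have hG' : a ≤ m ∧ (j ≤ m - a ∨ (2 * a ≤ m ∧ j + a ≤ jl)) := ⟨hG.1, hG.2.imp_left fun h1 => by omega⟩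
      exact ⟨by rw [levelSetDep_eq_of_generic_ramified hDρ hΘΘ hΘρ hvΘ hρϖ hϖE hh hμ hjl hj (Or.inr hG'), if_pos hG'],
        by rw [levelSetDep_eq_of_generic_ramified hDρ hΘΘ hΘρ hvΘ hρϖ hϖE hh' hμ hjl hj (Or.inr hG'), if_pos hG']⟩)
    (fun j a hj _ hnG hoff => by   -- (C-2OFF) ★ RamMDep
      have hnG' : ¬ (a ≤ m ∧ (j ≤ m - a ∨ (2 * a ≤ m ∧ j + a ≤ jl))) := fun h1 => hnG ⟨h1.1, h1.2.imp_left fun h2 => by omega⟩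
      exact ⟨by rw [levelSetDep_eq_of_generic_ramified hDρ hΘΘ hΘρ hvΘ hρϖ hϖE hh hμ hjl hj (Or.inl hoff), if_neg hnG'],
        by rw [levelSetDep_eq_of_generic_ramified hDρ hΘΘ hΘρ hvΘ hρϖ hϖE hh' hμ hjl hj (Or.inl hoff), if_neg hnG']⟩)
    hC2near hC2far
  exact hW

end Summit.HodgeConjecture.HodgeConjecture.Cruxes.H413.F0P3cDyRamToricCensusSumRamMWeldOfFrame

end
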